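import Summits.Langlands.Langlands.Theorems.PicardMuOrdinaryMuOrdinaryFamilyRTThorneDefs
import Summits.Langlands.Langlands.Theorems.PicardMuOrdinaryMuOrdinaryFamilyRTPointAbsIrr
import Literature.NumberTheory.GaloisRepresentations.ExtendedAdequateSubgroup
import Literature.NumberTheory.GaloisRepresentations.ResidualGaloisRep
import Literature.NumberTheory.GaloisRepresentations.PolarizedDeformationRing
import HarnessLib

/-!
# Crux `MuOrdinaryFamilyRT` (stmt-Langlands-13757), line `thorne-minimal-lift`: the typed DEBTS of the
# Galois-side stubs (Defs file no. 2 of the line; companion of `…ThorneDefs` p137392, `…ThorneReduction` p140646)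

Wave 1 of the line (lead prover-line-stmt-Langlands-13757-c3-0, 2026-08-17) returned `stub-blocked` for the two
Galois-side stubs `T.stub_minimalFamily` (K2⁺) and `T.stub_finiteOverWeights`, each with the blocking statement
TYPED and elaborated against the tree.  This file lands those statements — `def … : Prop` only, nothing asserted —
so that (i) the reduction `stub_finiteOverWeights_of : LambdaOrdinaryMinimalFinite → RbarExtendedAdequate →
T.stub_finiteOverWeights` is kernel-checked in the tree, (ii) the tenure planner can file the two UNPRINTED ports
(`Missing.minimalOrdinaryBranch`, `LambdaOrdinaryMinimalFinite`) as conjecture / bridge items citing tree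
declarations, and (iii) the dischargeable bookkeeping `RbarExtendedAdequate` (GHT 2017 Thm 1.7, tree named fact
`ght2017_adequate_or_index_p_or_psl29`) has a name (registered helper `rbarExtendedAdequate`, wave 2).

Contents.
* § 1 `Missing.picardPolarized` (P0: `ρ_C` is polarized in trace form with multiplier `ε⁻¹` — a cite clause the
  Picard fact `picardCurve_exists_lambdaAdicRep` lacks) and `Missing.minimalOrdinaryBranch` (M1: an integral
  B-ordinary minimal branch of dimension `≥ 4` of the universal polarized deformation ring through a B-ordinary,
  potentially unramified characteristic-zero point — Kisin generic-fibre representability + Greenberg–Wiles count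
  with `E`-coefficients + Geraghty's flag scheme, at the prime RAMIFIED in `K = ℚ(ζ₃)`, printed nowhere as such).
* § 2 `LambdaOrdinaryMinimalFinite` (the `Λ`-adic `R^{red} = T^{ord}` finiteness port at `p = n = 3`, `ζ₃ ∈ K`,
  family form), `LambdaOrdinaryMinimalFiniteUniversal` (the same in the universal form the tree's
  `PolarizedDeformationRing` lets one state), `RbarExtendedAdequate` (the `S₄` heart is extended-adequate).
* § 3 `ordFamily_algebraMap_injective` (`𝒪 ↪ R` for an `OrdFamily`: the Picard point is a retraction) and the
  reduction `stub_finiteOverWeights_of` (registered on the crux item).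

Audit summaries (full reports: item evidence `stub_minimalFamily.md`, `stub_finiteOverWeights.md`): neither stub is
provable from the `OrdFamily` axioms (no finiteness / no deformation theory beyond `PolarizedDeformationRing` in
the tree), neither is refutable (no junk family: constant families have dimension `1`, twists the anticyclotomic
line of dimension `2`, inflation is killed by `generated` / `weightsGenerate` / `ordinaryAt`), and pointwise
automorphy does NOT give `Module.Finite Λ R` (`R = 𝒪⟦T,X⟧/(TX − 3)` over `Λ = 𝒪⟦T⟧`: every weight fibre has
`≤ 1` point, `R/TR` infinite).
-/

set_option linter.dupNamespace false

namespace Summit.Langlands.Langlands.Cruxes.MuOrdinaryFamilyRT.ThorneMinimalLift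

open scoped NumberField Polynomial Matrix Classical
open Field IsDedekindDomain Polynomial
open Literature.NumberTheory.GaloisRepresentations Literature.NumberTheory.Automorphic
open Summit.Langlands.Langlands.Cruxes.MuOrdinaryFamilyRT.CharZeroDominance

noncomputable section

/-! ## 1. Debts of `stub_minimalFamily` (K2⁺) -/


/-- **P0 (missing Picard fact): the representation pinned by `PicardInput` is polarized in trace form,
`tr ρ_C(θ_c σ) = ε(σ)⁻¹ · tr ρ_C(σ⁻¹)` for every complex conjugation `c ∈ Γ_ℚ`.**  True: `PicardInput`
pins `ρ_C` up to isomorphism (Chebotarev + continuity + Brauer–Nesbitt), and the `ω`-eigenpart `V_ω` of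
`H¹_et(C_f)` satisfies `V_ω^c ≅ V_{ω̄} ≅ V_ω^∨ ⊗ ε⁻¹` (complex conjugation swaps the eigenparts of
`[ω]^*`; the Weil pairing is isotropic on `V_ω` and pairs it perfectly with `V_{ω̄}` into `ℚ₃(-1)`), so
`m = -1`.  Not derivable from `PicardInput ∧ MainClassPlus` inside the tree (no `H¹_et`); it is the
polarization clause that `picardCurve_exists_lambdaAdicRep` lacks. -/
def Missing.picardPolarized : Prop :=
  ∀ (f : ℤ[X]) (ι : PadicAlgCl 3 ≃+* ℂ) (e : K →+* ℂ) (S₀ : Finset (HeightOneSpectrum (𝓞 K)))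
    (ρC : FramedGaloisRep K (PadicAlgCl 3) 3),
    Generic f → PicardInput f ι e S₀ ρC →
    ∀ c : absoluteGaloisGroup ℚ, IsComplexConjugation (algebraMap ℚ ℝ) c →
      ∀ σ : absoluteGaloisGroup K,
        FramedRep.trace ρC (absGaloisOuterConj ℚ K c σ) =
          algebraMap ℤ_[3] (PadicAlgCl 3)
              (((GaloisRep.cyclotomicCharacter K 3 σ) ^ (-1 : ℤ) : ℤ_[3]ˣ) : ℤ_[3]) *
            FramedRep.trace ρC σ⁻¹

/-- **M1 (THE first missing theorem; unprinted assembly): an integral B-ordinary minimal branch of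
dimension `≥ 4` of the universal polarized deformation ring through a B-ordinary, potentially unramified
characteristic-zero point.**

Setting (all tree vocabulary): `𝒪` a DVR finite over `ℤ₃` with residue map onto `𝔽₃`, embedded in `ℚ̄₃`
by `j`; `𝒟 : PolarizedDatum ℚ K 3 3 𝒪 (ZMod 3)` with scalar centralizer, polarized along the complex
conjugations; `𝓡 : PolarizedDeformationRing 𝒟` (exists: `polarizedDeformationRing_nonempty_holds`);
`x : 𝓡.R →ₐ[𝒪] 𝒪` a point with `ρ_x = j ∘ x ∘ ρ^univ` (`r̄` absolutely irreducible, Burnside form) such that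
(i) at `v ∣ 3`, `ρ_x|Γ_{K_v}` is upper triangular in a frame `g` with diagonal characters `δ v 0, δ v 1,
δ v 2` that are pairwise distinct and satisfy `δ v i ≠ ε · δ v j` for `i < j` (so `H⁰(K_λ, ad/𝔟) = 0`:
the flag deforms uniquely; and `H²(K_λ, 𝔟) = H⁰(K_λ, 𝔟^∨(1))^* = 0`);
(ii) at `v ∈ S`, `v ∤ 3`, `ρ_x` kills an open subgroup `U v` of inertia.
Conclusion: a complete Noetherian local DOMAIN `R'` with residue field `𝔽₃`, an `𝒪`-algebra map
`φ : 𝓡.R → R'`, a point `x'` of `R'` above `x`, `4 ≤ dim R'`, and weights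
`wt v i : Γ_{K_v} → R'` multiplicative and continuous on inertia, specialising at `x'` to `δ v i` on
inertia, such that `R'` is topologically generated over `𝒪` by `φ(𝓡.R)` and the inertial weight
values, EVERY ring map `z : R' → ℚ̄₃` makes `z ∘ φ ∘ ρ^univ` upper triangular at `v ∣ 3` with diagonal
inertial characters `z ∘ wt v i`, and `φ ∘ ρ^univ` kills `U v ∩ I_v` at `v ∈ S ∖ 3` (minimal family).

Intended proof (each step absent from the tree): the trace-polarized functor of the residually
absolutely irreducible `r̄` is CHT's `𝒢₃`-deformation functor over `F⁺ = ℚ`; impose minimality at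
`v ∈ S ∖ 3` (closed condition `ρ(U_v) = 1`; local lifting ring formally smooth of relative dimension
`9` in characteristic `0`: `H²(G_v/U_v, ad) = H²(Ẑ, ad^{I}) = 0`); Kisin: the completed local ring of
`R^{pol,min}[1/3]` at `x` pro-represents the same problem for `ρ_x` on Artinian `E`-algebras, and its
flag-preserving closed subfunctor (unique flag by (i)) is `E⟦x₁,…,x_g⟧/(f₁,…,f_r)` with
`g − r ≥ h⁰(G_ℚ, ad r) − h⁰(G_ℚ, ad r(1)) + (h¹(G_{ℚ₃}, 𝔟̃) − h⁰(G_{ℚ₃}, ad r)) + Σ_{v∤3} 0 − h⁰(G_ℝ, ad r)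
= 0 − 0 + 6 − 3 = 3` (`c` acts by `−1` on scalars; `ρ_x ≄ ρ_x(1)` by determinants; local Euler
characteristic `[ℚ₃:ℚ₃]·dim 𝔟 = 6` with `h²(𝔟̃) = 0` by (i); symmetric pairing for `n = 3` odd);
contract a minimal prime of that quotient to `𝔮 ⊂ R^{pol,min}`, `dim R/𝔮 ≥ 3 + 1`; the B-ordinary
locus is the (closed) image of the `Γ_{K_λ}`-fixed locus of the proper flag scheme (Geraghty), it
contains `Spec R/𝔮`; `R'` := closure of `(R/𝔮)[δ^univ(I_λ)]` inside `𝒪(Z)` for the irreducible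
component `Z ∋ (x, Fil_x)` of the fixed locus over `R/𝔮` (finite, so `dim R' = dim R/𝔮 ≥ 4`; residue
field `𝔽₃` because `x'` is an `𝒪`-point).  Sources of the ingredients: Kisin, Invent. Math. 153
(2003) Prop. 9.5 and JAMS 21 (2008) (2.3.5); Allen, arXiv:1411.7661 §§1–2 (polarized Selmer count
with `E`-coefficients); Geraghty, Math. Ann. 373 (2019) §3; Clozel–Harris–Taylor 2008 §§2.2–2.3;
Matsumura Thms 8.4, 15.6, 31.6 — NONE treats the place `3` ramified in `K/ℚ` (formal but unwritten). -/
def Missing.minimalOrdinaryBranch : Prop :=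
  ∀ (𝒪 : Type) [CommRing 𝒪] [IsDomain 𝒪] [IsDiscreteValuationRing 𝒪] [Algebra ℤ_[3] 𝒪]
    [Module.Finite ℤ_[3] 𝒪] [IsAdicComplete (IsLocalRing.maximalIdeal 𝒪) 𝒪] [Algebra 𝒪 (ZMod 3)]
    (j : 𝒪 →+* PadicAlgCl 3), Function.Injective j →
      j.comp (algebraMap ℤ_[3] 𝒪) = algebraMap ℤ_[3] (PadicAlgCl 3) →
    ∀ (𝒟 : PolarizedDatum ℚ K 3 3 𝒪 (ZMod 3)) (𝓡 : PolarizedDeformationRing 𝒟) (x : 𝓡.R →ₐ[𝒪] 𝒪)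
      (U : (v : HeightOneSpectrum (𝓞 K)) → OpenSubgroup (absoluteGaloisGroup (v.adicCompletion K)))
      (δ : (v : HeightOneSpectrum (𝓞 K)) → Fin 3 → absoluteGaloisGroup (v.adicCompletion K) → PadicAlgCl 3)
      (ρx : absoluteGaloisGroup K →* GL (Fin 3) (PadicAlgCl 3)),
      -- `r̄` absolutely irreducible, in Burnside form (⇒ `𝒟.HasScalarCentralizer`, `hasScalarCentralizer_of_span_eq_top`)
      Submodule.span (ZMod 3) (Set.range fun γ => (𝒟.residual γ : Matrix (Fin 3) (Fin 3) (ZMod 3))) = ⊤ →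
      𝒟.Θ = {c | IsComplexConjugation (algebraMap ℚ ℝ) c} →
      ρx = (Matrix.GeneralLinearGroup.map (j.comp (x : 𝓡.R →+* 𝒪))).comp 𝓡.ρ →
      -- (i) B-ordinary at `v ∣ 3`, pairwise distinct diagonal characters, `δ v i ≠ ε · δ v j` for `i < j`
      (∀ v : HeightOneSpectrum (𝓞 K), (3 : 𝓞 K) ∈ v.asIdeal →
        (∃ g : GL (Fin 3) (PadicAlgCl 3),
          (∀ τ, IsUpper3 (g⁻¹ * ρx (absGaloisRestrict K (v.adicCompletion K) τ) * g).val) ∧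
          (∀ τ (i : Fin 3), (g⁻¹ * ρx (absGaloisRestrict K (v.adicCompletion K) τ) * g).val i i = δ v i τ)) ∧
        (∀ i i' : Fin 3, i ≠ i' → δ v i ≠ δ v i') ∧
        (∀ i i' : Fin 3, i < i' → δ v i ≠ fun τ =>
          algebraMap ℤ_[3] (PadicAlgCl 3)
              ((GaloisRep.cyclotomicCharacter (v.adicCompletion K) 3 τ : ℤ_[3]ˣ) : ℤ_[3]) * δ v i' τ)) →
      -- (ii) potentially unramified (minimal datum `U v`) at `v ∈ S`, `v ∤ 3`
      (∀ v ∈ 𝒟.S, (3 : 𝓞 K) ∉ v.asIdeal →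
        ∀ τ ∈ absInertia (v.adicCompletion K), τ ∈ U v →
          ρx (absGaloisRestrict K (v.adicCompletion K) τ) = 1) →
      ∃ (R' : Type) (_ : CommRing R') (_ : IsDomain R') (_ : IsLocalRing R') (_ : IsNoetherianRing R')
        (_ : Algebra 𝒪 R') (_ : IsAdicComplete (IsLocalRing.maximalIdeal R') R')
        (π' : R' →ₐ[𝒪] ZMod 3) (φ : 𝓡.R →ₐ[𝒪] R') (x' : R' →ₐ[𝒪] 𝒪)
        (wt : (v : HeightOneSpectrum (𝓞 K)) → Fin 3 → absoluteGaloisGroup (v.adicCompletion K) → R'),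
        Function.Surjective π' ∧ x'.comp φ = x ∧ ((4 : ℕ) : WithBot ℕ∞) ≤ ringKrullDim R' ∧
        -- weights: multiplicative and continuous on inertia, equal to `δ` at `x'` on inertia
        (∀ v : HeightOneSpectrum (𝓞 K), (3 : 𝓞 K) ∈ v.asIdeal → ∀ i : Fin 3,
          ∀ τ ∈ absInertia (v.adicCompletion K), ∀ τ' ∈ absInertia (v.adicCompletion K),
            wt v i (τ * τ') = wt v i τ * wt v i τ') ∧
        (∀ v : HeightOneSpectrum (𝓞 K), (3 : 𝓞 K) ∈ v.asIdeal → ∀ (i : Fin 3) (N : ℕ),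
          ∃ W : OpenSubgroup (absoluteGaloisGroup (v.adicCompletion K)),
            ∀ τ ∈ absInertia (v.adicCompletion K), τ ∈ W →
              wt v i τ - 1 ∈ IsLocalRing.maximalIdeal R' ^ N) ∧
        (∀ v : HeightOneSpectrum (𝓞 K), (3 : 𝓞 K) ∈ v.asIdeal → ∀ i : Fin 3,
          ∀ τ ∈ absInertia (v.adicCompletion K), j (x' (wt v i τ)) = δ v i τ) ∧
        -- `R'` is topologically generated over `𝒪` by `φ(𝓡.R)` and the inertial weight values
        (∀ (r : R') (N : ℕ), ∃ a ∈ Algebra.adjoin 𝒪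
            (Set.range φ ∪ {c : R' | ∃ (v : HeightOneSpectrum (𝓞 K)) (i : Fin 3)
              (τ : absoluteGaloisGroup (v.adicCompletion K)),
              (3 : 𝓞 K) ∈ v.asIdeal ∧ τ ∈ absInertia (v.adicCompletion K) ∧ c = wt v i τ}),
            r - a ∈ IsLocalRing.maximalIdeal R' ^ N) ∧
        -- EVERY `ℚ̄₃`-point is B-ordinary at `v ∣ 3` with diagonal inertial characters `z ∘ wt v i`
        (∀ (z : R' →+* PadicAlgCl 3) (v : HeightOneSpectrum (𝓞 K)), (3 : 𝓞 K) ∈ v.asIdeal →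
          ∃ g : GL (Fin 3) (PadicAlgCl 3),
            (∀ τ, IsUpper3 (g⁻¹ * Matrix.GeneralLinearGroup.map (z.comp (φ : 𝓡.R →+* R'))
              (𝓡.ρ (absGaloisRestrict K (v.adicCompletion K) τ)) * g).val) ∧
            ∀ τ ∈ absInertia (v.adicCompletion K), ∀ i : Fin 3,
              (g⁻¹ * Matrix.GeneralLinearGroup.map (z.comp (φ : 𝓡.R →+* R'))
                (𝓡.ρ (absGaloisRestrict K (v.adicCompletion K) τ)) * g).val i i = z (wt v i τ)) ∧
        -- the branch is minimal away from `3`, uniformly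
        (∀ v ∈ 𝒟.S, (3 : 𝓞 K) ∉ v.asIdeal →
          ∀ τ ∈ absInertia (v.adicCompletion K), τ ∈ U v →
            Matrix.GeneralLinearGroup.map (φ : 𝓡.R →+* R') (𝓡.ρ (absGaloisRestrict K (v.adicCompletion K) τ)) = 1)



/-! ## 2. Debts of `stub_finiteOverWeights`: the `Λ`-adic finiteness port and the image bookkeeping -/

/-- **`LambdaOrdinaryMinimalFinite` — `Λ`-adic `R^{red} = T^{ord}` finiteness at `p = n = 3` over
`K = ℚ(ζ₃)`, family form (ABSENT; a PORT, not a printed theorem).**  Let `𝒪` be a DVR finite over `ℤ₃`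
with residue field `𝔽₃`; `S ∋ λ` a finite set of finite places of `K`; `r̄ : Γ_K → GL₃(𝔽₃)` absolutely
irreducible with extended-adequate image (`Subgroup.IsExtendedAdequate`, Thorne 2017 Def. 2.20 = GHT §1;
`K(ζ₃) = K`); `m ∈ ℤ`.  Let `R` be a complete Noetherian local `𝒪`-DOMAIN with residue field `𝔽₃` and
`𝒪 ↪ R`, carrying `ρ : Γ_K → GL₃(R)` continuous, lifting `r̄`, unramified outside `S`, polarized in
trace form with exponent `m`, potentially unramified (an open subgroup of inertia acts trivially) at
`v ∈ S`, `v ∤ 3`; and let `Λ → R` be a weight algebra EXACTLY as in `OrdFamily` (`wt_mul`, `wt_cont`,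
`closedRange`, `weightsGenerate`, `generated`, `ordinaryAt`: closed image topologically generated by `𝒪`
and the diagonal inertial characters at `λ`, `R` topologically generated over `Λ` by the characteristic
polynomials of `ρ`, every `ℚ̄₃`-point of `R` B-ordinary at `λ` with diagonal inertial characters read
through `Λ`).  THEN `R` is a finite `Λ`-module.
Equivalent (universality of the tree's `PolarizedDeformationRing`, Zariski density of `ℚ̄₃`-points of
the `𝒪`-flat domain `R`, compactness of `R`) to: the ordinary-`S`-minimal reduced quotient of
`R^{univ,pol}_S(r̄) ⊗̂_𝒪 Λ^{wt}` (`Λ^{wt} = 𝒪⟦(𝒪_{K_λ}^×(3))³⟧`, Geraghty's `R^△`) is finite over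
`Λ^{wt}`; intended proof = Geraghty's `Λ`-adic ordinary patching on the definite `U(3)_{F'/F'⁺}`,
`F' = K(√d)`, at the split prime above `3`, with Thorne 2017 Prop. 2.21 / Def. 2.20 + GHT 2017 Thm 1.7
as image / Taylor–Wiles inputs, and BLGGT Lemma 1.2.3 from `F'` down to `K`.  No printed statement
covers `p = n`, `ζ_p ∈ K`, `p` ramified in `K`.  [Geraghty, Math. Ann. 373 (2019) §§3–5; Thorne,
Math. Z. 285 (2017) Prop. 2.21, Def. 2.20, Thm 4.2; Guralnick–Herzig–Tiep, JEMS 19 (2017) Thm 1.7;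
BLGGT, Ann. Math. 179 (2014) Lemma 1.2.3] -/
def LambdaOrdinaryMinimalFinite : Prop :=
  ∀ (𝒪 : Type) [CommRing 𝒪] [IsDomain 𝒪] [IsDiscreteValuationRing 𝒪] [Algebra ℤ_[3] 𝒪]
    [Module.Finite ℤ_[3] 𝒪] [Algebra 𝒪 (ZMod 3)],
    Function.Surjective (algebraMap 𝒪 (ZMod 3)) →
  ∀ (S : Finset (HeightOneSpectrum (𝓞 K))) (rb : absoluteGaloisGroup K →* GL (Fin 3) (ZMod 3)) (m : ℤ),
    (∀ v : HeightOneSpectrum (𝓞 K), ((3 : ℕ) : 𝓞 K) ∈ v.asIdeal → v ∈ S) →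
    IsAbsIrreducible rb → Subgroup.IsExtendedAdequate rb.range →
  ∀ (R : Type) [CommRing R] [IsDomain R] [IsLocalRing R] [IsNoetherianRing R] [Algebra 𝒪 R]
    [IsAdicComplete (IsLocalRing.maximalIdeal R) R] (π : R →ₐ[𝒪] ZMod 3),
    Function.Surjective π → Function.Injective (algebraMap 𝒪 R) →
  ∀ (ρ : absoluteGaloisGroup K →* GL (Fin 3) R),
    -- continuous, lifts `r̄`, unramified outside `S`
    Deformation.IsAdicContinuous ρ →
    (∀ σ, (ρ σ).val.map (π : R →+* ZMod 3) = (rb σ).val) →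
    (∀ v : HeightOneSpectrum (𝓞 K), v ∉ S → Deformation.IsUnramifiedAt v ρ) →
    -- polarized in trace form with exponent `m`
    (∀ c : absoluteGaloisGroup ℚ, IsComplexConjugation (algebraMap ℚ ℝ) c →
      ∀ σ, (ρ (absGaloisOuterConj ℚ K c σ)).val.trace =
        algebraMap 𝒪 R (algebraMap ℤ_[3] 𝒪 (((GaloisRep.cyclotomicCharacter K 3 σ) ^ m : ℤ_[3]ˣ) : ℤ_[3])) *
          (ρ σ⁻¹).val.trace) →
    -- minimal (potentially unramified) at the places of `S` away from `3`
    (∀ v ∈ S, ((3 : ℕ) : 𝓞 K) ∉ v.asIdeal →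
      ∃ U : OpenSubgroup (absoluteGaloisGroup (v.adicCompletion K)),
        ∀ τ ∈ absInertia (v.adicCompletion K), τ ∈ U → ρ (absGaloisRestrict K (v.adicCompletion K) τ) = 1) →
  ∀ (Λ : Type) [CommRing Λ] [Algebra Λ R]
    (wt : (v : HeightOneSpectrum (𝓞 K)) → Fin 3 → absoluteGaloisGroup (v.adicCompletion K) → Λ),
    -- `wt_mul`
    (∀ v : HeightOneSpectrum (𝓞 K), (3 : 𝓞 K) ∈ v.asIdeal → ∀ i : Fin 3,
      ∀ τ ∈ absInertia (v.adicCompletion K), ∀ τ' ∈ absInertia (v.adicCompletion K),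
        wt v i (τ * τ') = wt v i τ * wt v i τ') →
    -- `wt_cont`
    (∀ v : HeightOneSpectrum (𝓞 K), (3 : 𝓞 K) ∈ v.asIdeal → ∀ (i : Fin 3) (N : ℕ),
      ∃ U : OpenSubgroup (absoluteGaloisGroup (v.adicCompletion K)),
        ∀ τ ∈ absInertia (v.adicCompletion K), τ ∈ U →
          algebraMap Λ R (wt v i τ) - 1 ∈ IsLocalRing.maximalIdeal R ^ N) →
    -- `closedRange`
    (∀ r : R, (∀ N : ℕ, ∃ a : Λ, r - algebraMap Λ R a ∈ IsLocalRing.maximalIdeal R ^ N) →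
      r ∈ (algebraMap Λ R).range) →
    -- `weightsGenerate`
    (∀ (a : Λ) (N : ℕ),
      ∃ b ∈ Algebra.adjoin ℤ
          ({c : R | ∃ (v : HeightOneSpectrum (𝓞 K)) (i : Fin 3)
              (τ : absoluteGaloisGroup (v.adicCompletion K)),
              (3 : 𝓞 K) ∈ v.asIdeal ∧ τ ∈ absInertia (v.adicCompletion K) ∧
                c = algebraMap Λ R (wt v i τ)} ∪ Set.range (algebraMap 𝒪 R)),
        algebraMap Λ R a - b ∈ IsLocalRing.maximalIdeal R ^ N) →
    -- `generated`
    (∀ (r : R) (N : ℕ),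
      ∃ a ∈ Algebra.adjoin Λ {c : R | ∃ (σ : absoluteGaloisGroup K) (i : ℕ), c = ((ρ σ).val.charpoly).coeff i},
        r - a ∈ IsLocalRing.maximalIdeal R ^ N) →
    -- `ordinaryAt`
    (∀ (z : R →+* PadicAlgCl 3) (v : HeightOneSpectrum (𝓞 K)), (3 : 𝓞 K) ∈ v.asIdeal →
      ∃ g : GL (Fin 3) (PadicAlgCl 3),
        (∀ τ, IsUpper3 (g⁻¹ * Matrix.GeneralLinearGroup.map z
          (ρ (absGaloisRestrict K (v.adicCompletion K) τ)) * g).val) ∧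
        ∀ τ ∈ absInertia (v.adicCompletion K), ∀ i : Fin 3,
          (g⁻¹ * Matrix.GeneralLinearGroup.map z (ρ (absGaloisRestrict K (v.adicCompletion K) τ)) * g).val
              i i = z (algebraMap Λ R (wt v i τ))) →
    Module.Finite Λ R

/-- **`LambdaOrdinaryMinimalFiniteUniversal` — the same port in UNIVERSAL form, i.e. what the tree's
`PolarizedDeformationRing` lets one STATE.**  The `Λ`-ordinary condition is NOT a deformation condition
here (the residual flag at `λ` is not distinguished — `OrdinaryPolarizedDeformationRing` /
`ordinaryPolarizedDeformationRing_nonempty` need `IsDistinguishedAt`, empty for the Picard heart at `λ`,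
`Negative/HeartKlein`), so "the universal `Λ`-ordinary minimal polarized deformation ring" exists only as
an IMAGE (Geraghty's `R^△`): with `𝓡 : PolarizedDeformationRing 𝒟` (no condition at `3`; existence PROVED
in the tree, `polarizedDeformationRing_nonempty_holds`) and a `Λ₀ = 𝒪⟦T₁,T₂,T₃⟧`-valued weight `wt`
(multiplicative and continuous on inertia at `λ`), form `A = 𝓡.R⟦T₁,T₂,T₃⟧ = 𝓡.R ⊗̂_𝒪 Λ₀` and the ideal
`I = ⋂ ker z` over the integral continuous `ℚ̄₃`-points `z` of `A` at which `z ∘ ρ^{univ}` is B-ordinary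
at `λ` with diagonal inertial characters `z ∘ wt` and potentially unramified at `S ∖ λ`.  STATEMENT:
`A ⧸ I` is a finite `Λ₀`-module.  (⟸ finiteness of `R^△_{min}` over `Λ^{wt}` by base change along
`Λ^{wt} → Λ₀`; ⟹ `LambdaOrdinaryMinimalFinite` for families with `Λ ≃ 𝒪⟦T₁,T₂,T₃⟧` by universality,
Zariski density of `ℚ̄₃`-points and compactness; both directions are glue absent from the tree —
completed tensor products, density of `ℚ̄₃`-points in `𝒪`-flat complete local domains, local class
field theory for the inertial characters.)  Same sources and same status (unprinted port) as
`LambdaOrdinaryMinimalFinite`. -/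
def LambdaOrdinaryMinimalFiniteUniversal : Prop :=
  ∀ (𝒪 : Type) [CommRing 𝒪] [IsDomain 𝒪] [IsDiscreteValuationRing 𝒪] [Algebra ℤ_[3] 𝒪]
    [Module.Finite ℤ_[3] 𝒪] [Algebra 𝒪 (ZMod 3)]
    (𝒟 : PolarizedDatum ℚ K 3 3 𝒪 (ZMod 3)) (𝓡 : PolarizedDeformationRing 𝒟),
    IsAbsIrreducible 𝒟.residual → Subgroup.IsExtendedAdequate 𝒟.residual.range →
    𝒟.Θ = {c : absoluteGaloisGroup ℚ | IsComplexConjugation (algebraMap ℚ ℝ) c} →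
  ∀ (wt : (v : HeightOneSpectrum (𝓞 K)) → Fin 3 → absoluteGaloisGroup (v.adicCompletion K) →
      MvPowerSeries (Fin 3) 𝒪),
    (∀ v : HeightOneSpectrum (𝓞 K), (3 : 𝓞 K) ∈ v.asIdeal → ∀ i : Fin 3,
      ∀ τ ∈ absInertia (v.adicCompletion K), ∀ τ' ∈ absInertia (v.adicCompletion K),
        wt v i (τ * τ') = wt v i τ * wt v i τ') →
    (∀ v : HeightOneSpectrum (𝓞 K), (3 : 𝓞 K) ∈ v.asIdeal → ∀ (i : Fin 3) (N : ℕ),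
      ∃ U : OpenSubgroup (absoluteGaloisGroup (v.adicCompletion K)),
        ∀ τ ∈ absInertia (v.adicCompletion K), τ ∈ U →
          wt v i τ - 1 ∈ IsLocalRing.maximalIdeal (MvPowerSeries (Fin 3) 𝒪) ^ N) →
    Module.Finite (MvPowerSeries (Fin 3) 𝒪)
      (MvPowerSeries (Fin 3) 𝓡.R ⧸
        ⨅ z ∈ {z : MvPowerSeries (Fin 3) 𝓡.R →+* PadicAlgCl 3 |
            (∀ a, ‖z a‖ ≤ 1) ∧
            (∀ N : ℕ, ∃ M : ℕ, ∀ a ∈ IsLocalRing.maximalIdeal (MvPowerSeries (Fin 3) 𝓡.R) ^ M,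
              ‖z a‖ ≤ ((3 : ℝ)⁻¹) ^ N) ∧
            (∀ v : HeightOneSpectrum (𝓞 K), (3 : 𝓞 K) ∈ v.asIdeal →
              ∃ g : GL (Fin 3) (PadicAlgCl 3),
                (∀ τ, IsUpper3 (g⁻¹ * Matrix.GeneralLinearGroup.map
                  (z.comp (MvPowerSeries.C : 𝓡.R →+* MvPowerSeries (Fin 3) 𝓡.R))
                  (𝓡.ρ (absGaloisRestrict K (v.adicCompletion K) τ)) * g).val) ∧
                ∀ τ ∈ absInertia (v.adicCompletion K), ∀ i : Fin 3,
                  (g⁻¹ * Matrix.GeneralLinearGroup.map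
                    (z.comp (MvPowerSeries.C : 𝓡.R →+* MvPowerSeries (Fin 3) 𝓡.R))
                    (𝓡.ρ (absGaloisRestrict K (v.adicCompletion K) τ)) * g).val i i =
                    z (algebraMap (MvPowerSeries (Fin 3) 𝒪) (MvPowerSeries (Fin 3) 𝓡.R) (wt v i τ))) ∧
            (∀ v ∈ 𝒟.S, ((3 : ℕ) : 𝓞 K) ∉ v.asIdeal →
              ∃ U : OpenSubgroup (absoluteGaloisGroup (v.adicCompletion K)),
                ∀ τ ∈ absInertia (v.adicCompletion K), τ ∈ U →
                  Matrix.GeneralLinearGroup.map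
                    (z.comp (MvPowerSeries.C : 𝓡.R →+* MvPowerSeries (Fin 3) 𝓡.R))
                    (𝓡.ρ (absGaloisRestrict K (v.adicCompletion K) τ)) = 1)},
          RingHom.ker z)



/-- **`RbarExtendedAdequate` — for generic `f` with `disc f ∉ ℚ^{×2} ∪ (−3)ℚ^{×2}` (so `Gal(f/K) = S₄`,
`K = ℚ(√−3)`), the image of the framed heart `r̄_f^B : Γ_K → GL₃(𝔽₃)` is adequate in the extended
sense.**  `r̄_f^B(Γ_K) ≅ S₄` acts faithfully and absolutely irreducibly (tree: `rbarAbsIrreducible`) on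
the `3`-dimensional heart; by Guralnick–Herzig–Tiep Thm 1.7 (tree named fact
`ght2017_adequate_or_index_p_or_psl29`) it is adequate unless `S₄` has an abelian normal subgroup of
index `3` (it has none: the normal subgroups are `1, V₄, A₄, S₄`) or its image in `PGL₃(𝔽₃)` is
`PSL₂(9) ≅ A₆` (impossible, `24 < 360`).  Recorded as a statement (the Galois-theoretic step
"`Gal(K(f)/K) = S₄` from the two discriminant conditions" and the exclusion of (b), (c) are not yet in
the tree).  [Guralnick–Herzig–Tiep, JEMS 19 (2017) Thm 1.7; Thorne, Math. Z. 285 (2017) Def. 2.20] -/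
def RbarExtendedAdequate : Prop :=
  ∀ (f : ℤ[X]) (B : Module.Basis (Fin 3) (ZMod 3) (Heart 3 (Roots f))), Generic f →
    ¬ IsSquare (f.map (Int.castRingHom ℚ)).discr →
    ¬ IsSquare ((-3 : ℚ) * (f.map (Int.castRingHom ℚ)).discr) →
    Subgroup.IsExtendedAdequate (rbar f B).range

/-! ## 3. `stub_finiteOverWeights` is exactly the two statements of § 2 applied to the fields of `OrdFamily` -/

/-- For an `OrdFamily`, the coefficient ring embeds in the ring of the family: the Picard point
`x : R →ₐ[𝒪] 𝒪` is a retraction of `𝒪 → R`.  (This — and not the Picard traces — is what finiteness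
uses of `x`: it puts `R` in characteristic `0`.) -/
theorem ordFamily_algebraMap_injective {f : ℤ[X]} {ι : PadicAlgCl 3 ≃+* ℂ} {e : K →+* ℂ}
    {S₀ : Finset (HeightOneSpectrum (𝓞 K))} {ρC : FramedGaloisRep K (PadicAlgCl 3) 3}
    (𝓕 : OrdFamily f ι e S₀ ρC) : Function.Injective (algebraMap 𝓕.𝒪 𝓕.R) := by
  intro a b hab
  have h := congrArg 𝓕.x hab
  rwa [AlgHom.commutes, AlgHom.commutes] at h

/-- **`stub_finiteOverWeights` reduced to the port.**  `T.stub_finiteOverWeights` follows from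
`LambdaOrdinaryMinimalFinite` (the absent `Λ`-adic `R^{red} = T` finiteness) and `RbarExtendedAdequate`
(GHT bookkeeping), by feeding the fields of `𝓕 : OrdFamily` and the hypotheses `PotUnramifiedFamily 𝓕`,
`λ ∈ S₀` (`PicardInput`), `Gal(f/K) = S₄` (`MainClass`), `r̄` absolutely irreducible (tree
`rbarAbsIrreducible`) and `𝒪 ↪ R` (`ordFamily_algebraMap_injective`); the hypotheses `4 ≤ dim R` and
`Λ ≃ 𝒪⟦T₁,T₂,T₃⟧` of the stub are not used. -/
theorem stub_finiteOverWeights_of :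
    LambdaOrdinaryMinimalFinite → RbarExtendedAdequate → T.stub_finiteOverWeights := by
  intro hfin hadq f ι e S₀ ρC 𝓕 hgen hin hM _hdim hpur _hΛ
  have hS : ∀ v : HeightOneSpectrum (𝓞 K), ((3 : ℕ) : 𝓞 K) ∈ v.asIdeal → v ∈ S₀ := hin.1
  have hirr : IsAbsIrreducible (rbar f 𝓕.B) := FreeSeedSmoothRt.rbarAbsIrreducible f 𝓕.B hgen
  have hadq' : Subgroup.IsExtendedAdequate (rbar f 𝓕.B).range := hadq f 𝓕.B hgen hM.1.2.1 hM.1.2.2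
  exact hfin 𝓕.𝒪 𝓕.residue_surjective S₀ (rbar f 𝓕.B) 𝓕.m hS hirr hadq' 𝓕.R 𝓕.π 𝓕.π_surjective
    (ordFamily_algebraMap_injective 𝓕) 𝓕.ρ 𝓕.continuous 𝓕.residual 𝓕.unramified 𝓕.polarized hpur 𝓕.Λ 𝓕.wt
    𝓕.wt_mul 𝓕.wt_cont 𝓕.closedRange 𝓕.weightsGenerate 𝓕.generated 𝓕.ordinaryAt

end

end Summit.Langlands.Langlands.Cruxes.MuOrdinaryFamilyRT.ThorneMinimalLift
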